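import Summits.CriticalPhenomena.PercolationContinuityZ3.Theorems.Transplant.DiamondFilmThreeComb
import HarnessLib

/-!
# The diamond `(001)`-films of EVEN thickness carry the quarter turn: `(x₀, x₁, x₂) ↦ (x₁ + c_k, −x₀, k − x₂)` is a graph automorphism of `D_k` (`c_k = 0, 2` for `k ≡ 0, 2 (4)`),
# acting on the planar shadow `(u, v) = ((x₀+x₁)/2, (x₀−x₁)/2)` as a rotation by 90° (up to translation) — the `D₄` hypothesis of a square-shadow DST transplant

builds on p205010 (kernel theorem, internal audit signed; external expert review pending) — NOT used in this file.
Lane `prim-bschramm`, seat `prim-bschramm-p2` (gen 40; class C1b, METHOD = input substitution; memo `HOME/bschramm/P2-LATTICES.md` §142 (3)); helper file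
(`--supports stmt-CriticalPhenomena-4575 --as helper`).

THE POINT (memo §142).  A bond of the diamond lattice changes all three bcc coordinates by `±1`; bonds from even heights have planar displacement `±(1,1)` (unit `u`-steps,
`u = (x₀+x₁)/2`), bonds from odd heights `±(1,−1)` (unit `v`-steps).  The plain quarter turn of the plane exchanges the two classes and is NOT an automorphism of any film; composed
with the level flip `h ↦ k − h` it becomes one exactly when `k` is EVEN (the flip exchanges the classes iff `k` is even; for odd `k` the classes number `(k+1)/2 ≠ (k−1)/2` and no
automorphism exchanges them — only the rectangle group acts, memo §142 (4)).  Kernel record of the positive half: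
* `DiamondFilm.adj_iff_crd` (adjacency in `D_k` = all coordinates change by `±1`), `DiamondFilm.shift k` (`c_k`);
* **`DiamondFilm.rotFlipIso (hk : Even k) : diamondGraph.induce (diamondFilm k) ≃g diamondGraph.induce (diamondFilm k)`**, `x ↦ (x₁ + c_k, −x₀, k − x₂)`, with inverse
  `x ↦ (−x₁, x₀ − c_k, k − x₂)`;
* `DiamondFilm.uv` (the planar shadow `(u, v)`, `1`-Lipschitz in each coordinate along bonds: `uv_step`) and **`uv_rotFlip`**: `uv (rotFlip x) = (−v + c_k/2, u + c_k/2)` — a rotation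
  by 90° of the shadow plane followed by a translation.
[cite: ConwaySloane1999, Ch. 4 §7.3] [cite: DuminilCopinSidoraviciusTassion2016, §2 (the symmetries used: "invariant under the reflections and rotations of ℤ²")]
[cite: BenjaminiSchramm1996, Conj. 4 / Question 3]
-/

noncomputable section

namespace Summit.CriticalPhenomena.PercolationContinuityZ3.Theorems.Transplant

open Literature.Probability.Percolation Literature.Probability.LatticeModels SimpleGraph

namespace DiamondFilm

variable {k : ℕ}

/-- The ambient coordinates of a film vertex. [folklore] -/
def crd (x : diamondFilm k) : Site 3 := ((x : diamondSite) : Site 3)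

/-- The arithmetic of a film vertex. [cite: ConwaySloane1999, Ch. 4 §7.3] -/
theorem crd_facts (x : diamondFilm k) :
    crd x 0 % 2 = crd x 2 % 2 ∧ crd x 1 % 2 = crd x 2 % 2 ∧ ((crd x 0 + crd x 1 + crd x 2) % 4 = 0 ∨ (crd x 0 + crd x 1 + crd x 2) % 4 = 3) ∧
      0 ≤ crd x 2 ∧ crd x 2 ≤ k := by
  obtain ⟨h0, h1, h2⟩ := (mem_diamondSite_iff _).1 (x : diamondSite).2
  obtain ⟨h3, h4⟩ := (mem_diamondFilm (k := k)).1 x.2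
  exact ⟨h0, h1, h2, h3, h4⟩

/-- Two film vertices with the same coordinates are equal. [folklore] -/
theorem ext_crd {x y : diamondFilm k} (h : ∀ i, crd x i = crd y i) : x = y := Subtype.ext (Subtype.ext (funext h))

/-- **Adjacency in `D_k`**: all three coordinates change by `±1`. [cite: ConwaySloane1999, Ch. 4 §7.3] -/
theorem adj_iff_crd (x y : diamondFilm k) :
    (diamondGraph.induce (diamondFilm k)).Adj x y ↔ ∀ i, crd x i - crd y i = 1 ∨ crd x i - crd y i = -1 := by
  constructor
  · intro h i
    have h' : diamondGraph.Adj (x : diamondSite) (y : diamondSite) := h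
    have := diamond_abs_sub_eq_one h' i
    rw [abs_eq (by norm_num : (0 : ℤ) ≤ 1)] at this
    exact this
  · intro h
    change diamondGraph.Adj (x : diamondSite) (y : diamondSite)
    rw [diamondGraph_adj, bccGraph_adj]
    refine ⟨fun heq => ?_, ?_⟩
    · have := h 0
      have h0 : crd x 0 = crd y 0 := congrFun heq 0
      omega
    · have hsq : ∀ i, (crd x i - crd y i) ^ 2 = 1 := fun i => by rcases h i with h' | h' <;> rw [h'] <;> norm_num
      simp only [Fin.sum_univ_three]
      change (crd x 0 - crd y 0) ^ 2 + (crd x 1 - crd y 1) ^ 2 + (crd x 2 - crd y 2) ^ 2 = 3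
      rw [hsq 0, hsq 1, hsq 2]; norm_num

/-- Adjacency in coordinates, conjunction form. [folklore] -/
theorem adj_crd_iff (x y : diamondFilm k) : (diamondGraph.induce (diamondFilm k)).Adj x y ↔
    (crd x 0 - crd y 0 = 1 ∨ crd x 0 - crd y 0 = -1) ∧ (crd x 1 - crd y 1 = 1 ∨ crd x 1 - crd y 1 = -1) ∧ (crd x 2 - crd y 2 = 1 ∨ crd x 2 - crd y 2 = -1) := by
  rw [adj_iff_crd, Fin.forall_fin_succ, Fin.forall_fin_two]; rfl

/-! ## §1 The quarter turn ∘ level flip (even thickness) -/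

/-- The translation correction `c_k`: `0` if `4 ∣ k`, else `2`. [folklore] -/
def shift (k : ℕ) : ℤ := if (k : ℤ) % 4 = 0 then 0 else 2

/-- `c_k ∈ {0, 2}` and `c_k + k ≡ 0 (4)` for even `k`. [folklore] -/
theorem shift_facts (hk : Even k) : (shift k = 0 ∧ (k : ℤ) % 4 = 0) ∨ (shift k = 2 ∧ (k : ℤ) % 4 = 2) := by
  obtain ⟨m, rfl⟩ := hk
  unfold shift
  split_ifs with h
  · exact Or.inl ⟨rfl, h⟩
  · right; refine ⟨rfl, ?_⟩; push_cast at h ⊢; omega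

/-- The image point `(x₁ + c_k, −x₀, k − x₂)`. [folklore] -/
def rotFlipSite (k : ℕ) (a : Site 3) : Site 3 := ![a 1 + shift k, -a 0, (k : ℤ) - a 2]

/-- The inverse image point `(−x₁, x₀ − c_k, k − x₂)`. [folklore] -/
def rotFlipInvSite (k : ℕ) (a : Site 3) : Site 3 := ![-a 1, a 0 - shift k, (k : ℤ) - a 2]

/-- For even `k` the quarter turn ∘ flip preserves the film. [cite: ConwaySloane1999, Ch. 4 §7.3] -/
theorem rotFlipSite_mem (hk : Even k) (x : diamondFilm k) : rotFlipSite k (crd x) ∈ diamondSite ∧ 0 ≤ rotFlipSite k (crd x) 2 ∧ rotFlipSite k (crd x) 2 ≤ (k : ℤ) := by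
  obtain ⟨p0, p1, p4, hz0, hzk⟩ := crd_facts x
  have e0 : rotFlipSite k (crd x) 0 = crd x 1 + shift k := rfl
  have e1 : rotFlipSite k (crd x) 1 = -crd x 0 := rfl
  have e2 : rotFlipSite k (crd x) 2 = (k : ℤ) - crd x 2 := rfl
  rw [mem_diamondSite_iff, e0, e1, e2]
  rcases shift_facts hk with ⟨hs, hk4⟩ | ⟨hs, hk4⟩ <;> rw [hs] <;> omega

/-- For even `k` the inverse map preserves the film. [cite: ConwaySloane1999, Ch. 4 §7.3] -/
theorem rotFlipInvSite_mem (hk : Even k) (x : diamondFilm k) :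
    rotFlipInvSite k (crd x) ∈ diamondSite ∧ 0 ≤ rotFlipInvSite k (crd x) 2 ∧ rotFlipInvSite k (crd x) 2 ≤ (k : ℤ) := by
  obtain ⟨p0, p1, p4, hz0, hzk⟩ := crd_facts x
  have e0 : rotFlipInvSite k (crd x) 0 = -crd x 1 := rfl
  have e1 : rotFlipInvSite k (crd x) 1 = crd x 0 - shift k := rfl
  have e2 : rotFlipInvSite k (crd x) 2 = (k : ℤ) - crd x 2 := rfl
  rw [mem_diamondSite_iff, e0, e1, e2]
  rcases shift_facts hk with ⟨hs, hk4⟩ | ⟨hs, hk4⟩ <;> rw [hs] <;> omega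

/-- **The quarter turn ∘ level flip** on `D_k`, `k` even. [folklore] -/
def rotFlip (hk : Even k) (x : diamondFilm k) : diamondFilm k :=
  ⟨⟨rotFlipSite k (crd x), (rotFlipSite_mem hk x).1⟩, by rw [mem_diamondFilm]; exact ⟨(rotFlipSite_mem hk x).2.1, by exact_mod_cast (rotFlipSite_mem hk x).2.2⟩⟩

/-- Its inverse. [folklore] -/
def rotFlipInv (hk : Even k) (x : diamondFilm k) : diamondFilm k :=
  ⟨⟨rotFlipInvSite k (crd x), (rotFlipInvSite_mem hk x).1⟩, by rw [mem_diamondFilm]; exact ⟨(rotFlipInvSite_mem hk x).2.1, by exact_mod_cast (rotFlipInvSite_mem hk x).2.2⟩⟩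

/-- Coordinates of `rotFlip`. [folklore] -/
theorem crd_rotFlip (hk : Even k) (x : diamondFilm k) :
    crd (rotFlip hk x) 0 = crd x 1 + shift k ∧ crd (rotFlip hk x) 1 = -crd x 0 ∧ crd (rotFlip hk x) 2 = (k : ℤ) - crd x 2 := ⟨rfl, rfl, rfl⟩

/-- Coordinates of `rotFlipInv`. [folklore] -/
theorem crd_rotFlipInv (hk : Even k) (x : diamondFilm k) :
    crd (rotFlipInv hk x) 0 = -crd x 1 ∧ crd (rotFlipInv hk x) 1 = crd x 0 - shift k ∧ crd (rotFlipInv hk x) 2 = (k : ℤ) - crd x 2 := ⟨rfl, rfl, rfl⟩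

/-- The two maps are inverse bijections. [folklore] -/
def rotFlipEquiv (hk : Even k) : diamondFilm k ≃ diamondFilm k where
  toFun := rotFlip hk
  invFun := rotFlipInv hk
  left_inv x := by
    obtain ⟨a0, a1, a2⟩ := crd_rotFlipInv hk (rotFlip hk x)
    obtain ⟨b0, b1, b2⟩ := crd_rotFlip hk x
    apply ext_crd; intro i; fin_cases i
    · show crd (rotFlipInv hk (rotFlip hk x)) 0 = crd x 0; omega
    · show crd (rotFlipInv hk (rotFlip hk x)) 1 = crd x 1; omega
    · show crd (rotFlipInv hk (rotFlip hk x)) 2 = crd x 2; omega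
  right_inv x := by
    obtain ⟨a0, a1, a2⟩ := crd_rotFlip hk (rotFlipInv hk x)
    obtain ⟨b0, b1, b2⟩ := crd_rotFlipInv hk x
    apply ext_crd; intro i; fin_cases i
    · show crd (rotFlip hk (rotFlipInv hk x)) 0 = crd x 0; omega
    · show crd (rotFlip hk (rotFlipInv hk x)) 1 = crd x 1; omega
    · show crd (rotFlip hk (rotFlipInv hk x)) 2 = crd x 2; omega

/-- **THE QUARTER TURN ∘ LEVEL FLIP IS A GRAPH AUTOMORPHISM OF `D_k` FOR EVEN `k`** (it is an isometry of the bcc frame composed with a translation, so all coordinates still change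
by `±1` along bonds). [cite: ConwaySloane1999, Ch. 4 §7.3] [cite: DuminilCopinSidoraviciusTassion2016, §2] -/
def rotFlipIso (hk : Even k) : diamondGraph.induce (diamondFilm k) ≃g diamondGraph.induce (diamondFilm k) where
  toEquiv := rotFlipEquiv hk
  map_rel_iff' := by
    intro x y
    show (diamondGraph.induce (diamondFilm k)).Adj (rotFlip hk x) (rotFlip hk y) ↔ (diamondGraph.induce (diamondFilm k)).Adj x y
    obtain ⟨a0, a1, a2⟩ := crd_rotFlip hk x
    obtain ⟨b0, b1, b2⟩ := crd_rotFlip hk y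
    rw [adj_crd_iff, adj_crd_iff, a0, a1, a2, b0, b1, b2]
    constructor
    · rintro ⟨h0, h1, h2⟩; refine ⟨?_, ?_, ?_⟩ <;> omega
    · rintro ⟨h0, h1, h2⟩; refine ⟨?_, ?_, ?_⟩ <;> omega

/-! ## §2 The planar shadow and the action of the quarter turn on it -/

/-- **The planar shadow** `(u, v) = ((x₀+x₁)/2, (x₀−x₁)/2)` (integers: `x₀ ≡ x₁ (2)`). [cite: ConwaySloane1999, Ch. 4 §7.3] -/
def uv (x : diamondFilm k) : Site 2 := ![(crd x 0 + crd x 1) / 2, (crd x 0 - crd x 1) / 2]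

/-- Coordinates of the shadow. [folklore] -/
theorem uv_apply (x : diamondFilm k) : uv x 0 = (crd x 0 + crd x 1) / 2 ∧ uv x 1 = (crd x 0 - crd x 1) / 2 := ⟨rfl, rfl⟩

/-- **Bonds are unit axis steps of the shadow**: along a bond exactly one of `u, v` changes, by `±1` (`u` iff the lower endpoint has even height).
[cite: ConwaySloane1999, Ch. 4 §7.3] -/
theorem uv_step {x y : diamondFilm k} (h : (diamondGraph.induce (diamondFilm k)).Adj x y) :
    (uv x 1 = uv y 1 ∧ (uv x 0 - uv y 0 = 1 ∨ uv x 0 - uv y 0 = -1)) ∨ (uv x 0 = uv y 0 ∧ (uv x 1 - uv y 1 = 1 ∨ uv x 1 - uv y 1 = -1)) := by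
  obtain ⟨px0, px1, -, -, -⟩ := crd_facts x
  obtain ⟨py0, py1, -, -, -⟩ := crd_facts y
  obtain ⟨ex0, ex1⟩ := uv_apply x
  obtain ⟨ey0, ey1⟩ := uv_apply y
  rw [adj_crd_iff] at h
  obtain ⟨h0, h1, -⟩ := h
  rw [ex0, ex1, ey0, ey1]
  have hx : (crd x 0 + crd x 1) % 2 = 0 := by omega
  have hy : (crd y 0 + crd y 1) % 2 = 0 := by omega
  rcases h0 with h0 | h0 <;> rcases h1 with h1 | h1 <;> omega

/-- **The quarter turn acts on the shadow as a rotation by 90° followed by a translation**: `uv (rotFlip x) = (−v + c_k/2, u + c_k/2)`.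
[cite: DuminilCopinSidoraviciusTassion2016, §2 (rotation of the coarse lattice)] -/
theorem uv_rotFlip (hk : Even k) (x : diamondFilm k) :
    uv (rotFlip hk x) 0 = -uv x 1 + shift k / 2 ∧ uv (rotFlip hk x) 1 = uv x 0 + shift k / 2 := by
  obtain ⟨px0, px1, -, -, -⟩ := crd_facts x
  obtain ⟨a0, a1, -⟩ := crd_rotFlip hk x
  obtain ⟨ex0, ex1⟩ := uv_apply x
  obtain ⟨fx0, fx1⟩ := uv_apply (rotFlip hk x)
  rw [fx0, fx1, ex0, ex1, a0, a1]
  rcases shift_facts hk with ⟨hs, -⟩ | ⟨hs, -⟩ <;> rw [hs] <;> omega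

end DiamondFilm

end Summit.CriticalPhenomena.PercolationContinuityZ3.Theorems.Transplant

end
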